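import Literature.NumberTheory.Automorphic.CuspTowerInduction
import HarnessLib

/-!
# The Fourier–Whittaker tower of a cusp form as a recursion, and genericity of cusp forms on
`GL_n` in mean square (Shalika (1974), Thm. 5.9; Piatetski-Shapiro (1979); Cogdell (2004), §1.1,
Thm. 1.1 and Cor.: "cusp forms on `GL_n` are generic")

Topic `NumberTheory/Automorphic`; namespace `Literature.NumberTheory.Automorphic`. This file packages
the column coefficients of the preceding files (`MirabolicFourierStage`, `MirabolicTowerInvariance`,
`CuspTowerTransport`, `CuspTowerColumn`, `CuspTowerInduction`) into **the tower**

  `Φ_{n-1} = φ`,  `Φ_c = (Φ_{c+1})_{e_c}`  (`c + 2 ≤ n`; the coefficient along the column group of size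
  `c + 1` at the character `ψ(v_c)`),

so that `Φ_0 = W_φ` is the global `ψ`-Whittaker coefficient computed column by column
(`fwTower ν φ c`; any family `ν` of additive Haar measures, the values do not depend on it), and
proves, for `φ : GL_n(𝔸_K) → ℂ` continuous, left `GL_n(K)`-invariant and cuspidal
(`CuspConditionGL n K φ k` for `0 < k < n`):

* `stageHyp_fwTower` — **every level of the tower satisfies the hypotheses of the stage identity**
  (continuity, invariance under the rational corner `diag(GL_{c+1}(K), 1)`, periodicity under the
  rational column group, and the cusp invariant `TowerCusp (c + 2 ≤ n)`), by downward induction from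
  `φ` (`StageHyp`, `StageHyp.colCoeff`);
* `hasSum_norm_sq_fwTower` — **the stage identity along the tower**:
  `∑_{γ ∈ P_{c+1}(K)\GL_{c+1}(K)} |Φ_c(diag(γ,1) x)|² = λ(D)⁻¹ ∫_D |Φ_{c+1}(u(v) x)|² dλ(v)` for every
  `c + 2 ≤ n` and every `x` (Parseval; `hasSum_norm_sq_colCoeff_mirabolic`);
* `eq_zero_of_setIntegral_piFundamentalDomain_eq_zero` — a continuous non-negative `K^ι`-periodic
  function with vanishing box integral vanishes (descent to the compact quotient `𝔸_K^ι ⧸ K^ι`);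
* `fwTower_succ_eq_zero` and `eq_zero_of_fwTower_zero_eq_zero` — **genericity in mean square**: if
  `Φ_c ≡ 0` then `Φ_{c+1} ≡ 0`; hence **a continuous cuspidal `φ` whose Whittaker coefficient
  `Φ_0` vanishes identically is zero** (Shalika (1974), Thm. 5.9 / Piatetski-Shapiro: cusp forms on
  `GL_n` are generic; here for the mean-square tower, with no smoothness, `K`-finiteness or
  absolute convergence of Fourier expansions).

No measure theory on `GL_n(𝔸_K)` is used: everything is pointwise in `x`.

## References

* J. A. Shalika, *The multiplicity one theorem for GL_n*, Ann. of Math. 100 (1974), §5, Thm. 5.9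
  [Shalika1974].
* J. W. Cogdell, in Bernstein–Gelbart (eds.), *An Introduction to the Langlands Program* (2004),
  §1.1, Thm. 1.1 [CogdellAnalyticTheory2004].
* H. Jacquet, J. A. Shalika, Amer. J. Math. 103 (1981), §4 [JacquetShalikaAJM1981].
-/

noncomputable section

open scoped Matrix ComplexConjugate ENNReal NNReal Pointwise
open NumberField IsDedekindDomain MeasureTheory Function
open Literature.LinearAlgebra.Matrix

namespace Literature.NumberTheory.Automorphic

/-! ### Casting the corner size -/

section Cast

variable {K : Type} [Field K] [NumberField K] {n : ℕ} [MeasurableSpace (AdeleRing (𝓞 K) K)]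

/-- `TowerCusp` does not depend on how the corner size is written. [folklore] -/
theorem towerCusp_congr {m m' : ℕ} (e : m = m') (hm : m ≤ n) (hm' : m' ≤ n)
    (φ : GL (Fin n) (AdeleRing (𝓞 K) K) → ℂ) : TowerCusp (K := K) hm φ ↔ TowerCusp (K := K) hm' φ := by
  subst e
  exact Iff.rfl

end Cast

/-! ### Vanishing box integrals of periodic functions -/

section Vanish

variable (K : Type) [Field K] [NumberField K] [MeasurableSpace (AdeleRing (𝓞 K) K)]
  [BorelSpace (AdeleRing (𝓞 K) K)]

variable {K} in
/-- **A continuous non-negative `K^ι`-periodic function with vanishing box integral vanishes**: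
for `ν` an additive Haar measure on `𝔸_K^ι`, `F ≥ 0` continuous with
`F(v + ξ) = F(v)` (`ξ ∈ K^ι`) and `∫_{D^ι} F dν = 0`, `F ≡ 0` (descend `F` to the compact group
`𝔸_K^ι ⧸ K^ι`, where the integral against the Haar probability measure is `ν(D)⁻¹ ∫_D F`, Tate's
Lemma 4.2.1, and a continuous non-negative function with zero Haar integral vanishes).
[cite: CasselsFrohlichANT1967, Ch. XV Lemma 4.2.1] -/
theorem eq_zero_of_setIntegral_piFundamentalDomain_eq_zero {ι : Type} [Fintype ι]
    (ν : Measure (ι → AdeleRing (𝓞 K) K)) [ν.IsAddHaarMeasure]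
    {F : (ι → AdeleRing (𝓞 K) K) → ℝ} (hFc : Continuous F) (hF0 : ∀ v, 0 ≤ F v)
    (hper : ∀ (v : ι → AdeleRing (𝓞 K) K) (ξ : ι → K),
      F (v + fun i => algebraMap K (AdeleRing (𝓞 K) K) (ξ i)) = F v)
    (h : ∫ v in piFundamentalDomain K ι, F v ∂ν = 0) (v : ι → AdeleRing (𝓞 K) K) : F v = 0 := by
  haveI := locallyCompactSpace_adeleRing' K
  haveI := secondCountableTopology_adeleRing K
  haveI := t2Space_adeleRing K
  haveI : Countable K := NumberField.countable' (K := K)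
  haveI : BorelSpace (ι → AdeleRing (𝓞 K) K) := Pi.borelSpace
  letI : MeasurableSpace ((ι → AdeleRing (𝓞 K) K) ⧸ piPrincipalSubgroup K ι) := borel _
  haveI : BorelSpace ((ι → AdeleRing (𝓞 K) K) ⧸ piPrincipalSubgroup K ι) := ⟨rfl⟩
  have hD := isAddFundamentalDomain_op_piFundamentalDomain K ι ν
  have hfin : ν (piFundamentalDomain K ι) ≠ ⊤ :=
    ((measure_mono subset_closure).trans_lt (isCompact_closure_piFundamentalDomain K ι).measure_lt_top).ne
  have hν0 : ν ≠ 0 := fun h0 => by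
    have := isOpen_univ.measure_ne_zero ν Set.univ_nonempty
    rw [h0] at this
    exact this rfl
  have hne : ν (piFundamentalDomain K ι) ≠ 0 := hD.measure_ne_zero hν0
  -- descent of `F`
  have hF' : ∀ (w : ι → AdeleRing (𝓞 K) K) (γ : piPrincipalSubgroup K ι), F (w + γ) = F w := by
    intro w γ
    obtain ⟨ξ, hξ⟩ := (piPrincipalSubgroupEquiv K ι).surjective γ
    have : (γ : ι → AdeleRing (𝓞 K) K) = fun i => algebraMap K (AdeleRing (𝓞 K) K) (ξ i) := by
      rw [← hξ, coe_piPrincipalSubgroupEquiv]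
    rw [this]; exact hper w ξ
  let G : (ι → AdeleRing (𝓞 K) K) ⧸ piPrincipalSubgroup K ι → ℝ :=
    Quotient.lift (s := QuotientAddGroup.leftRel (piPrincipalSubgroup K ι)) F fun a b hab => by
      have hm : -a + b ∈ piPrincipalSubgroup K ι := QuotientAddGroup.leftRel_apply.1 hab
      have h' : F (a + (-a + b)) = F a := hF' a ⟨-a + b, hm⟩
      rw [add_neg_cancel_left] at h'
      exact h'.symm
  have hGmk : ∀ w, G (QuotientAddGroup.mk w) = F w := fun w => rfl
  have hGc : Continuous G := by
    rw [(QuotientAddGroup.isQuotientMap_mk (piPrincipalSubgroup K ι)).continuous_iff]; exact hFc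
  have hG0 : ∀ q, 0 ≤ G q := fun q => by
    induction q using QuotientAddGroup.induction_on with
    | H w => exact hF0 w
  set μQ : Measure ((ι → AdeleRing (𝓞 K) K) ⧸ piPrincipalSubgroup K ι) := Measure.addHaarMeasure ⊤
    with hμQ
  have h3 : ∫ w in piFundamentalDomain K ι, F w ∂ν = (ν (piFundamentalDomain K ι)).toReal • ∫ q, G q ∂μQ :=
    Literature.Analysis.Fourier.integral_fundamentalDomain_comp_mk ν (isClosed_piPrincipalSubgroup K ι)
      hD hfin (G := G) hGc.aestronglyMeasurable
  rw [h, eq_comm, smul_eq_zero] at h3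
  have hint : ∫ q, G q ∂μQ = 0 := by
    rcases h3 with h3 | h3
    · exact absurd h3 (ENNReal.toReal_ne_zero.2 ⟨hne, hfin⟩)
    · exact h3
  haveI : T2Space ((ι → AdeleRing (𝓞 K) K) ⧸ piPrincipalSubgroup K ι) := by
    haveI := isClosed_piPrincipalSubgroup K ι; infer_instance
  have hGi : Integrable G μQ :=
    integrableOn_univ.1 (hGc.continuousOn.integrableOn_compact isCompact_univ)
  have hae : G =ᵐ[μQ] 0 := (integral_eq_zero_iff_of_nonneg hG0 hGi).1 hint
  have hG : G = 0 := (Continuous.ae_eq_iff_eq μQ hGc continuous_const).1 hae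
  rw [← hGmk v, hG, Pi.zero_apply]

end Vanish

/-! ### The tower -/

section Tower

variable (K : Type) [Field K] [NumberField K] {n : ℕ} [MeasurableSpace (AdeleRing (𝓞 K) K)]

/-- **The Fourier–Whittaker tower** of `φ : GL_n(𝔸_K) → ℂ`: `fwTower ν φ c = φ` for `n ≤ c + 1`,
and `fwTower ν φ c = colCoeff (c + 1 ≤ n) (ν (c + 1)) (fwTower ν φ (c + 1)) e_c` for `c + 2 ≤ n`
(the coefficient along the column group of size `c + 1` at `ψ(v_c)`), for a family `ν` of
measures on the `𝔸_K^m` (Cogdell (2004), §1.1: `W_φ` computed along `N_n ⊃ U^{(2)} ⊃ ⋯`, one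
abelian column at a time). `fwTower ν φ 0` is the Whittaker coefficient of `φ`.
[cite: CogdellAnalyticTheory2004, §1.1] -/
def fwTower (ν : ∀ m : ℕ, Measure (Fin m → AdeleRing (𝓞 K) K)) (φ : GL (Fin n) (AdeleRing (𝓞 K) K) → ℂ)
    (c : ℕ) : GL (Fin n) (AdeleRing (𝓞 K) K) → ℂ :=
  if h : c + 2 ≤ n then
    fun x => colCoeff (show c + 1 ≤ n by omega) (ν (c + 1)) (fwTower ν φ (c + 1)) (lastVec c K) x
  else φ
  termination_by n - c

variable {K}

/-- The top of the tower: `fwTower ν φ c = φ` for `n ≤ c + 1`. [folklore] -/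
theorem fwTower_of_lt (ν : ∀ m : ℕ, Measure (Fin m → AdeleRing (𝓞 K) K))
    (φ : GL (Fin n) (AdeleRing (𝓞 K) K) → ℂ) {c : ℕ} (h : n < c + 2) : fwTower K ν φ c = φ := by
  rw [fwTower, dif_neg (not_le.2 h)]

/-- The recursion: `fwTower ν φ c = (fwTower ν φ (c+1))_{e_c}` for `c + 2 ≤ n`. [folklore] -/
theorem fwTower_of_le (ν : ∀ m : ℕ, Measure (Fin m → AdeleRing (𝓞 K) K))
    (φ : GL (Fin n) (AdeleRing (𝓞 K) K) → ℂ) {c : ℕ} (h : c + 2 ≤ n) (x : GL (Fin n) (AdeleRing (𝓞 K) K)) :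
    fwTower K ν φ c x =
      colCoeff (show c + 1 ≤ n by omega) (ν (c + 1)) (fwTower K ν φ (c + 1)) (lastVec c K) x := by
  rw [fwTower, dif_pos h]

/-- **The hypotheses of the stage identity at column size `c + 1`** for a function
`G : GL_n(𝔸_K) → ℂ`: continuity, left invariance under the rational corner `diag(GL_{c+1}(K), 1)`,
under the rational column group `u(K^{c+1})`, and the cusp invariant `TowerCusp (c + 2 ≤ n) G`
(all block constant terms inside the corner `GL_{c+2}` vanish). [cite: CogdellAnalyticTheory2004, §1.1] -/
structure StageHyp (c : ℕ) (h : c + 1 ≤ n) (h2 : c + 2 ≤ n)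
    (G : GL (Fin n) (AdeleRing (𝓞 K) K) → ℂ) : Prop where
  cont : Continuous G
  inv : ∀ (γ : GL (Fin (c + 1)) K) (x : GL (Fin n) (AdeleRing (𝓞 K) K)),
    G (glCorner (AdeleRing (𝓞 K) K) h (ratGL K γ) * x) = G x
  per : ∀ (κ : Fin (c + 1) → K) (x : GL (Fin n) (AdeleRing (𝓞 K) K)),
    G (colUnipotent n h (Multiplicative.ofAdd fun i => algebraMap K (AdeleRing (𝓞 K) K) (κ i)) * x) = G x
  cusp : TowerCusp h2 G

variable [BorelSpace (AdeleRing (𝓞 K) K)]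

/-- **The hypotheses descend one level**: if `G` satisfies them at column size `c + 2` then its
coefficient `G_{e_{c+1}}` satisfies them at column size `c + 1` (`colCoeff_invariant_glCorner`,
`colCoeff_invariant_colUnipotent`, `towerCusp_colCoeff`). [cite: CogdellAnalyticTheory2004, §1.1] -/
theorem StageHyp.colCoeff {c : ℕ} (h : c + 1 ≤ n) (h2 : c + 2 ≤ n) (h3 : c + 3 ≤ n)
    {G : GL (Fin n) (AdeleRing (𝓞 K) K) → ℂ} (hG : StageHyp (c + 1) h2 h3 G)
    (ν : Measure (Fin (c + 2) → AdeleRing (𝓞 K) K)) [ν.IsAddHaarMeasure] :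
    StageHyp c h h2 (fun x => colCoeff h2 ν G (lastVec (c + 1) K) x) where
  cont := continuous_colCoeff h2 ν hG.cont _
  inv γ x := colCoeff_invariant_glCorner h h2 ν hG.cont hG.inv hG.per γ x
  per κ x := colCoeff_invariant_colUnipotent h h2 ν hG.cont hG.inv hG.per κ x
  cusp := towerCusp_colCoeff h2 h3 hG.cont hG.per hG.cusp ν

/-- **The top of the tower**: a continuous, left `GL_n(K)`-invariant `φ` satisfying the cusp
conditions `CuspConditionGL n K φ k` (`0 < k < n`) satisfies the stage hypotheses at column size
`n - 1` (`2 ≤ n`; the rational corner and column group lie in `GL_n(K)`, `ratGL_glCorner`,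
`ratGL_colUnipotent`; the cusp invariant is `towerCusp_of_cuspConditionGL`). [cite: CogdellAnalyticTheory2004, §1.1] -/
theorem stageHyp_top {φ : GL (Fin n) (AdeleRing (𝓞 K) K) → ℂ}
    (hφc : Continuous φ)
    (hinv : ∀ (δ : GL (Fin n) K) (x : GL (Fin n) (AdeleRing (𝓞 K) K)), φ (ratGL K δ * x) = φ x)
    (hcusp : ∀ k, 0 < k → k < n → CuspConditionGL n K φ k)
    (h : n - 2 + 1 ≤ n) (h2 : n - 2 + 2 ≤ n) : StageHyp (n - 2) h h2 φ where
  cont := hφc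
  inv γ x := by rw [← ratGL_glCorner, hinv]
  per κ x := by rw [← ratGL_colUnipotent, hinv]
  cusp := (towerCusp_congr (by omega) (le_refl n) h2 φ).1 (towerCusp_of_cuspConditionGL hcusp)

/-- **Every level of the tower satisfies the stage hypotheses**: for `φ` continuous, left
`GL_n(K)`-invariant and cuspidal, `fwTower ν φ (c + 1)` satisfies `StageHyp c` for every
`c + 2 ≤ n` (downward induction on `c`). [cite: CogdellAnalyticTheory2004, §1.1] -/
theorem stageHyp_fwTower (ν : ∀ m : ℕ, Measure (Fin m → AdeleRing (𝓞 K) K))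
    [hν : ∀ m, (ν m).IsAddHaarMeasure] {φ : GL (Fin n) (AdeleRing (𝓞 K) K) → ℂ}
    (hφc : Continuous φ)
    (hinv : ∀ (δ : GL (Fin n) K) (x : GL (Fin n) (AdeleRing (𝓞 K) K)), φ (ratGL K δ * x) = φ x)
    (hcusp : ∀ k, 0 < k → k < n → CuspConditionGL n K φ k) :
    ∀ (d c : ℕ) (hdc : c + 2 + d = n) (h : c + 1 ≤ n) (h2 : c + 2 ≤ n),
      StageHyp c h h2 (fwTower K ν φ (c + 1)) := by
  intro d
  induction d with
  | zero =>
    intro c hdc h h2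
    have hc : c = n - 2 := by omega
    subst hc
    rw [fwTower_of_lt ν φ (by omega)]
    exact stageHyp_top hφc hinv hcusp h h2
  | succ d ih =>
    intro c hdc h h2
    have h3 : c + 3 ≤ n := by omega
    have hG := ih (c + 1) (by omega) h2 h3
    have e : fwTower K ν φ (c + 1) = fun x =>
        colCoeff h2 (ν (c + 2)) (fwTower K ν φ (c + 2)) (lastVec (c + 1) K) x :=
      funext fun x => fwTower_of_le ν φ h3 x
    rw [e]
    exact hG.colCoeff h h2 h3 (ν (c + 2))

/-- The same with the depth eliminated: `StageHyp c` for `fwTower ν φ (c + 1)` whenever `c + 2 ≤ n`.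
[cite: CogdellAnalyticTheory2004, §1.1] -/
theorem stageHyp_fwTower' (ν : ∀ m : ℕ, Measure (Fin m → AdeleRing (𝓞 K) K))
    [hν : ∀ m, (ν m).IsAddHaarMeasure] {φ : GL (Fin n) (AdeleRing (𝓞 K) K) → ℂ}
    (hφc : Continuous φ)
    (hinv : ∀ (δ : GL (Fin n) K) (x : GL (Fin n) (AdeleRing (𝓞 K) K)), φ (ratGL K δ * x) = φ x)
    (hcusp : ∀ k, 0 < k → k < n → CuspConditionGL n K φ k) {c : ℕ} (h : c + 1 ≤ n) (h2 : c + 2 ≤ n) :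
    StageHyp c h h2 (fwTower K ν φ (c + 1)) :=
  stageHyp_fwTower ν hφc hinv hcusp (n - (c + 2)) c (by omega) h h2

/-- **The stage identity along the tower** (Parseval on `K^{c+1}\𝔸_K^{c+1}`): for `φ` continuous,
left `GL_n(K)`-invariant and cuspidal, `c + 2 ≤ n` and every `x`,
`∑_{γ ∈ P_{c+1}(K)\GL_{c+1}(K)} |Φ_c(diag(γ_𝔸, 1) x)|² = λ(D)⁻¹ ∫_D |Φ_{c+1}(u(v) x)|² dλ(v)`,
`Φ_c = fwTower ν φ c`, `λ = ν (c+1)` (`hasSum_norm_sq_colCoeff_mirabolic` with the hypotheses of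
`stageHyp_fwTower` and `colCoeff_zero_eq_zero_of_towerCusp`). [cite: JacquetShalikaAJM1981, §4] -/
theorem hasSum_norm_sq_fwTower (ν : ∀ m : ℕ, Measure (Fin m → AdeleRing (𝓞 K) K))
    [hν : ∀ m, (ν m).IsAddHaarMeasure] {φ : GL (Fin n) (AdeleRing (𝓞 K) K) → ℂ}
    (hφc : Continuous φ)
    (hinv : ∀ (δ : GL (Fin n) K) (x : GL (Fin n) (AdeleRing (𝓞 K) K)), φ (ratGL K δ * x) = φ x)
    (hcusp : ∀ k, 0 < k → k < n → CuspConditionGL n K φ k) {c : ℕ} (h : c + 1 ≤ n) (h2 : c + 2 ≤ n)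
    (x : GL (Fin n) (AdeleRing (𝓞 K) K)) :
    HasSum (fun q : Quotient (QuotientGroup.rightRel (mirabolic c K)) =>
        ‖fwTower K ν φ c (glCorner (AdeleRing (𝓞 K) K) h (ratGL K q.out) * x)‖ ^ 2)
      (((ν (c + 1)) (piFundamentalDomain K (Fin (c + 1)))).toReal⁻¹ *
        ∫ v in piFundamentalDomain K (Fin (c + 1)),
          ‖fwTower K ν φ (c + 1) (colUnipotent n h (Multiplicative.ofAdd v) * x)‖ ^ 2 ∂(ν (c + 1))) := by
  have hG := stageHyp_fwTower' ν hφc hinv hcusp h h2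
  have hcusp0 : colCoeff h (ν (c + 1)) (fwTower K ν φ (c + 1)) 0 x = 0 :=
    colCoeff_zero_eq_zero_of_towerCusp h h2 hG.cusp (ν (c + 1)) x
  have hs := hasSum_norm_sq_colCoeff_mirabolic h (ν (c + 1)) hG.cont hG.inv hG.per x hcusp0
  refine hs.congr_fun fun q => ?_
  rw [fwTower_of_le ν φ h2]

/-- **Vanishing climbs the tower**: if `Φ_c ≡ 0` then `Φ_{c+1} ≡ 0` (`c + 2 ≤ n`): by the stage
identity the box integral of the continuous, non-negative, `K^{c+1}`-periodic function
`v ↦ |Φ_{c+1}(u(v) x)|²` vanishes for every `x`, hence the function vanishes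
(`eq_zero_of_setIntegral_piFundamentalDomain_eq_zero`), and `v = 0` gives `Φ_{c+1}(x) = 0`.
[cite: CogdellAnalyticTheory2004, §1.1] -/
theorem fwTower_succ_eq_zero (ν : ∀ m : ℕ, Measure (Fin m → AdeleRing (𝓞 K) K))
    [hν : ∀ m, (ν m).IsAddHaarMeasure] {φ : GL (Fin n) (AdeleRing (𝓞 K) K) → ℂ}
    (hφc : Continuous φ)
    (hinv : ∀ (δ : GL (Fin n) K) (x : GL (Fin n) (AdeleRing (𝓞 K) K)), φ (ratGL K δ * x) = φ x)
    (hcusp : ∀ k, 0 < k → k < n → CuspConditionGL n K φ k) {c : ℕ} (h2 : c + 2 ≤ n)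
    (h0 : ∀ x, fwTower K ν φ c x = 0) (x : GL (Fin n) (AdeleRing (𝓞 K) K)) :
    fwTower K ν φ (c + 1) x = 0 := by
  have h : c + 1 ≤ n := by omega
  have hG := stageHyp_fwTower' ν hφc hinv hcusp h h2
  set F : (Fin (c + 1) → AdeleRing (𝓞 K) K) → ℝ := fun v =>
    ‖fwTower K ν φ (c + 1) (colUnipotent n h (Multiplicative.ofAdd v) * x)‖ ^ 2 with hF
  have hFc : Continuous F :=
    (continuous_norm.comp (hG.cont.comp ((continuous_colUnipotent h).mul continuous_const))).pow 2
  have hF0 : ∀ v, 0 ≤ F v := fun v => sq_nonneg _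
  have hFper : ∀ (v : Fin (c + 1) → AdeleRing (𝓞 K) K) (ξ : Fin (c + 1) → K),
      F (v + fun i => algebraMap K (AdeleRing (𝓞 K) K) (ξ i)) = F v := by
    intro v ξ
    simp only [hF, periodic_comp_colUnipotent h hG.per x v ξ]
  have hsum := hasSum_norm_sq_fwTower ν hφc hinv hcusp h h2 x
  have hzero : HasSum (fun q : Quotient (QuotientGroup.rightRel (mirabolic c K)) =>
      ‖fwTower K ν φ c (glCorner (AdeleRing (𝓞 K) K) h (ratGL K q.out) * x)‖ ^ 2) 0 := by
    have : (fun q : Quotient (QuotientGroup.rightRel (mirabolic c K)) =>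
        ‖fwTower K ν φ c (glCorner (AdeleRing (𝓞 K) K) h (ratGL K q.out) * x)‖ ^ 2) = 0 := by
      funext q
      rw [h0, norm_zero, zero_pow two_ne_zero, Pi.zero_apply]
    rw [this]
    exact hasSum_zero
  have hval := hsum.unique hzero
  have hD0 : ((ν (c + 1)) (piFundamentalDomain K (Fin (c + 1)))).toReal⁻¹ ≠ 0 := by
    refine inv_ne_zero (ENNReal.toReal_ne_zero.2 ⟨?_, ?_⟩)
    · haveI := locallyCompactSpace_adeleRing' K
      haveI := secondCountableTopology_adeleRing K
      haveI := t2Space_adeleRing K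
      haveI : Countable K := NumberField.countable' (K := K)
      haveI : BorelSpace (Fin (c + 1) → AdeleRing (𝓞 K) K) := Pi.borelSpace
      exact (isAddFundamentalDomain_op_piFundamentalDomain K (Fin (c + 1)) (ν (c + 1))).measure_ne_zero
        (NeZero.ne _)
    · exact ((measure_mono subset_closure).trans_lt
        (isCompact_closure_piFundamentalDomain K (Fin (c + 1))).measure_lt_top).ne
  have hint : ∫ v in piFundamentalDomain K (Fin (c + 1)), F v ∂(ν (c + 1)) = 0 := by
    rcases mul_eq_zero.1 hval with h1 | h1
    · exact absurd h1 hD0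
    · simpa only [hF] using h1
  have hFv := eq_zero_of_setIntegral_piFundamentalDomain_eq_zero (ν (c + 1)) hFc hF0 hFper hint 0
  simp only [hF] at hFv
  rw [ofAdd_zero, map_one, one_mul] at hFv
  exact norm_eq_zero.1 (pow_eq_zero_iff two_ne_zero |>.1 hFv)

/-- **Genericity of cusp forms on `GL_n`, mean-square form** (Shalika (1974), Thm. 5.9;
Piatetski-Shapiro (1979); Cogdell (2004), §1.1): a continuous, left `GL_n(K)`-invariant
`φ : GL_n(𝔸_K) → ℂ` satisfying the cusp conditions and whose Whittaker coefficient
`fwTower ν φ 0` vanishes identically is identically zero (climb the tower: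
`Φ_0 ≡ 0 ⇒ Φ_1 ≡ 0 ⇒ ⋯ ⇒ Φ_{n-1} = φ ≡ 0`). [cite: Shalika1974, §5 Thm. 5.9] -/
theorem eq_zero_of_fwTower_zero_eq_zero (ν : ∀ m : ℕ, Measure (Fin m → AdeleRing (𝓞 K) K))
    [hν : ∀ m, (ν m).IsAddHaarMeasure] {φ : GL (Fin n) (AdeleRing (𝓞 K) K) → ℂ}
    (hφc : Continuous φ)
    (hinv : ∀ (δ : GL (Fin n) K) (x : GL (Fin n) (AdeleRing (𝓞 K) K)), φ (ratGL K δ * x) = φ x)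
    (hcusp : ∀ k, 0 < k → k < n → CuspConditionGL n K φ k)
    (h0 : ∀ x, fwTower K ν φ 0 x = 0) (x : GL (Fin n) (AdeleRing (𝓞 K) K)) : φ x = 0 := by
  have key : ∀ c, c + 1 ≤ n → ∀ y, fwTower K ν φ c y = 0 := by
    intro c
    induction c with
    | zero => intro _ y; exact h0 y
    | succ c ih =>
      intro hc y
      exact fwTower_succ_eq_zero ν hφc hinv hcusp hc (ih (by omega)) y
  by_cases hn : n = 0
  · subst hn
    have := h0 x
    rwa [fwTower_of_lt ν φ (by omega)] at this
  · have := key (n - 1) (by omega) x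
    rwa [fwTower_of_lt ν φ (by omega)] at this

end Tower

end Literature.NumberTheory.Automorphic
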